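import Literature.MathematicalPhysics.QuantumFieldTheory.Balaban1983to89.B15DeterminingSets

/-!
# `Balaban1983to89.B14Eq22Determines` — CMP 119 (2.2) p. 255: *"The set 𝐁 determines the sequence {Ω_j}"* — PROVED
# for the tree's determining set `B15DeterminingSets.genSet` (injectivity of `{Ω_j} ↦ 𝐁 = {Γ_j}` on nested sequences of
# block unions)

statement-level skeleton of published theorems with citation tags; proofs where landed; nothing here is a claim
about the Yang–Mills mass gap.

CITATION HEADER (lean-in-tree rule).  Source: T. Bałaban, *Convergent renormalization expansions for lattice gauge
theories*, Commun. Math. Phys. **119**, 243–285 (1988), doi:10.1007/bf01217741 [Balaban1988Convergent] (cell paper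
B14 = "[III]"; held `paper:balaban1988-cmp119-convergent-renormalization`, journal page = PDF page + 242; p. 255 read
on the x2 render `…-p013-x2.png` and the text layer).  Mega-formalization `lit-balaban`, unit `lit-balaban-r11`
(CMP 119), SKELETON row **B14.Eq2.2** (the determining set itself — `gammaRegion`, `genSet`, `pts` — is r12 gen 2
`B15DeterminingSets`, p243299, the CONCRETE companion of the row).

THE PRINTED TEXT (p. 255, verbatim): *"For a sequence {Ω_j}, where Ω_j are considered as subsets of T_η, we denote
  Γ₀ = Ω^c₁,  Γ_j = Ω_j^{(j)}∖Ω^{(j)}_{j+1},  j = 1, …, k − 1,  Γ_k = Ω_k^{(k)},  and  𝐁 = ∪_{j=0}^{k} Γ_j.   (2.2)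
This definition is meant for sets of points, bonds and plaquettes, with the convention described in Sect. 0 [I]. The
set 𝐁 determines the sequence {Ω_j}, and is called the determining set. The domain Ω₁, or rather a small neighborhood of
Ω₁ including a layer of M₁-cubes (…), is called its support."*  (Used on p. 258: *"This field is determined by the
sequence {Ω_j}, or rather its determining set 𝐁"* — print passes freely between `{Ω_j}` and `𝐁`.)

WHAT IS PROVED.  On r12's carrier (`Site P j` the `j`-th lattice, `pts j X = X^{(j)}` the `j`-points of a region
`X ⊂ T_η = Site P 0`, `genSet Ω k j = (Γ_j)` with `gammaRegion` verbatim): if two sequences `{Ω_j}`, `{Ω′_j}` are NESTED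
(`Ω_{j+1} ⊆ Ω_j`, part of admissibility (2.1)) and each `Ω_{j+1}`, `1 ≤ j < k`, is a UNION OF `j`-BLOCKS (membership of
`x` decided by the representative `j`-point of its `j`-block — weaker than print's "unions of big cubes" of (2.1)), then
`genSet Ω k = genSet Ω′ k` forces `Ω_j = Ω′_j` for `1 ≤ j ≤ k` (`eq_of_genSet_eq`).  Mechanism (§2): `Γ₀ = (Ω₁ᶜ)^{(0)} =
Ω₁ᶜ` recovers `Ω₁` outright (`omega_one_eq_of_genSet_eq`); upward in `j`, `Ω^{(j)}_{j+1} = Ω^{(j)}_j ∖ Γ_j` by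
nestedness (`pts_succ_eq_diff`), and a union of `j`-blocks is recovered from its `j`-points (`eq_of_pts_eq`).  §1: the
`j`-fold block map `blockIter j : T_η → T^{(j)}` (`x ↦` the `j`-block containing `x`) and the predicate `IsBlockUnion`.
Not here: admissibility (2.1) itself (row B14.Eq2.1, `Step`); the points/bonds/plaquettes convention and the support are pointers to Sect. 0 [I].  No
`sorry`.

v1.1 (lit-balaban-r11 gen 99, DOCSTRING-ONLY citation-locator fix; summit-lit1 CITELOC row P91-004 of gen 91, decision of
record «(B12, (0.1), p.252) → p.251»): the three §1 tags citing [I]'s lattice set-up (0.1) read «(0.1) p.252»; (0.1)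
«T_ε = {x ∈ εZ^d : −L_μ ≤ x_μ < L_μ, μ = 1, …, d}» (with the block lattices T^{(k)}_{L^kε} in the next sentence) is the
display of CMP **109** p. 251 [PDF 3, text layer p0003 L29–31]; p. 252 carries (0.2)–(0.3). The tags now read «(0.1)
p.251»; no declaration changed.
-/

open Set

namespace Literature.MathematicalPhysics.QuantumFieldTheory.Balaban1983to89.B14.Eq22Determines

open Literature.MathematicalPhysics.QuantumFieldTheory.Balaban1983to89 B15DeterminingSets

variable {P : Params}

/-! ## §1  The `j`-fold block map and unions of `j`-blocks -/

/-- The `j`-fold block map `T_η → T^{(j)}`: `x ↦` (the label of) the `j`-block containing `x`, iterating `Setup`'s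
`blockOf : T^{(i)} → T^{(i+1)}`. [cite: Balaban1987RG1, (0.1) p.251] -/
def blockIter : (j : ℕ) → Site P 0 → Site P j
  | 0 => fun x => x
  | j + 1 => fun x => blockOf (blockIter j x)

/-- `blockIter 0 = id`. [cite: Balaban1987RG1, (0.1) p.251] -/
@[simp] theorem blockIter_zero (x : Site P 0) : blockIter 0 x = x := rfl

/-- `blockIter (j+1) = blockOf ∘ blockIter j`. [cite: Balaban1987RG1, (0.1) p.251] -/
@[simp] theorem blockIter_succ (j : ℕ) (x : Site P 0) : blockIter (j + 1) x = blockOf (blockIter j x) := rfl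

/-- `X ⊂ T_η` is a UNION OF `j`-BLOCKS: whether `x ∈ X` is decided by the representative point `embIter j (blockIter j x)`
of the `j`-block of `x` (for `j` in the lattice range this is the centre of the block; [I] Sect. 0: regions "determine a
set of lattice points, of a given scale"; (2.1): the domains are unions of big cubes). [cite: Balaban1988Convergent, (2.1) p.255] -/
def IsBlockUnion (j : ℕ) (X : Set (Site P 0)) : Prop := ∀ x, x ∈ X ↔ embIter j (blockIter j x) ∈ X

/-- A union of `j`-blocks is recovered from its `j`-points: `x ∈ X ↔ blockIter j x ∈ X^{(j)}`.
[cite: Balaban1988Convergent, (2.2) p.255] -/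
theorem mem_iff_blockIter_mem_pts {j : ℕ} {X : Set (Site P 0)} (hX : IsBlockUnion j X) (x : Site P 0) :
    x ∈ X ↔ blockIter j x ∈ pts j X := by
  rw [mem_pts]; exact hX x

/-- Hence two unions of `j`-blocks with the same `j`-points coincide. [cite: Balaban1988Convergent, (2.2) p.255] -/
theorem eq_of_pts_eq {j : ℕ} {X Y : Set (Site P 0)} (hX : IsBlockUnion j X) (hY : IsBlockUnion j Y)
    (h : pts j X = pts j Y) : X = Y := by
  ext x
  rw [mem_iff_blockIter_mem_pts hX, mem_iff_blockIter_mem_pts hY, h]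

/-! ## §2  (2.2): `𝐁` determines `{Ω_j}` -/

section Determines

variable {Ω Ω' : ℕ → Set (Site P 0)} {k : ℕ}

/-- `Γ₀ = Ω₁ᶜ` recovers `Ω₁`: equal determining sets have equal first domains (`k ≥ 1`).
[cite: Balaban1988Convergent, (2.2) p.255] -/
theorem omega_one_eq_of_genSet_eq (hk : 0 < k) (h : genSet Ω k = genSet Ω' k) : Ω 1 = Ω' 1 := by
  have h0 := congrFun h 0
  simp only [genSet, gammaRegion_zero _ hk, pts_zero] at h0
  exact compl_inj_iff.mp h0

/-- Nestedness turns `Γ_j = Ω_j^{(j)}∖Ω^{(j)}_{j+1}` around: `Ω^{(j)}_{j+1} = Ω_j^{(j)} ∖ Γ_j` (`1 ≤ j < k`).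
[cite: Balaban1988Convergent, (2.2) p.255] -/
theorem pts_succ_eq_diff {j : ℕ} (h0 : 0 < j) (hjk : j < k) (hnest : Ω (j + 1) ⊆ Ω j) :
    pts j (Ω (j + 1)) = pts j (Ω j) \ genSet Ω k j := by
  simp only [genSet, gammaRegion_mid _ h0 hjk]
  ext y
  simp only [mem_pts, Set.mem_sdiff]
  constructor
  · intro hy; exact ⟨hnest hy, fun h => h.2 hy⟩
  · intro ⟨hy, hn⟩
    by_contra hc
    exact hn ⟨hy, hc⟩

/-- **(2.2) p. 255: "The set 𝐁 determines the sequence {Ω_j}."**  For nested sequences whose members `Ω_{j+1}`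
(`1 ≤ j < k`) are unions of `j`-blocks, `genSet Ω k = genSet Ω′ k` implies `Ω_j = Ω′_j` for every `1 ≤ j ≤ k`.
[cite: Balaban1988Convergent, (2.2) p.255] -/
theorem eq_of_genSet_eq (hk : 0 < k)
    (hnest : ∀ j, 1 ≤ j → j < k → Ω (j + 1) ⊆ Ω j) (hnest' : ∀ j, 1 ≤ j → j < k → Ω' (j + 1) ⊆ Ω' j)
    (hblk : ∀ j, 1 ≤ j → j < k → IsBlockUnion j (Ω (j + 1)))
    (hblk' : ∀ j, 1 ≤ j → j < k → IsBlockUnion j (Ω' (j + 1)))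
    (h : genSet Ω k = genSet Ω' k) :
    ∀ j, 1 ≤ j → j ≤ k → Ω j = Ω' j := by
  intro j hj1 hjk
  induction j with
  | zero => omega
  | succ i ih =>
    rcases Nat.eq_zero_or_pos i with hi0 | hi0
    · subst hi0
      exact omega_one_eq_of_genSet_eq hk h
    · have hik : i < k := by omega
      have hprev : Ω i = Ω' i := ih hi0 hik.le
      apply eq_of_pts_eq (hblk i hi0 hik) (hblk' i hi0 hik)
      rw [pts_succ_eq_diff hi0 hik (hnest i hi0 hik), pts_succ_eq_diff hi0 hik (hnest' i hi0 hik), hprev,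
        h]

end Determines

end Literature.MathematicalPhysics.QuantumFieldTheory.Balaban1983to89.B14.Eq22Determines
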